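import Summits.QuantumFields.YangMills.Theses.UnitScaleTilt
import Summits.QuantumFields.YangMills.Theorems.UnitScaleTiltFluctuationComparisonRegPrPrintChiWindow
import HarnessLib

/-!
# Crux-ideate seat `ym-cruxidea-19201-2` (ideator 2∕2, lens NEGATION) — GEN 14 sketch: C8 «edge-band-to-the-tail» × (R1) part 9∕10

Evidence for `stmt-QuantumFields-19201` ∕ `stmt-QuantumFields-19935` (crux `FluctuationComparisonRegPr[L]` of route `UnitScaleTilt`).  NO estimate is
asserted; nothing is proposed to the registry; every theorem below is bookkeeping over TREE theorems.

WHAT THIS FILE RECORDS (three typed facts the OWNER's C8 decision turns on):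

* §1 `FluctuationComparisonRegPrIntL` — the C8 item text 19935ᴵ written INLINE over tree declarations (no auxiliary definition: paste-ready for
  `ledger workitem add --signature`), `regPrIntL_of_regPrL : 19935 → 19935ᴵ` (the proposed text is formally WEAKER than the item of record), and
  `regPrIntL_iff_nested` (it is `Iff.rfl`-equal to the nested text `…Ideate2Excision.FluctuationComparisonRegPrIntL` against which the re-glued deciding
  theorem `closesInt : MinimiserStabilityRegPr → 19935ᴵ → HistoryTailL → YM3TorusSU2` was kernel-checked in `Sketch_ideator2_g13.lean` §6).
* §2 `θBal_inv_mul` — the C8 interior in the ITEM's spelling `PlaqSmall (θBal F.L γ (c·b₀) p₀ n)` with `c = C′⁻¹` IS lane (R1)'s shrunken window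
  `PlaqSmall (θBal F.L γ b₀ p₀ n / C′)` of `…PrintChiWindow` §3 (p533343), `C′ = max 1 (2B₃/((1−μ)·L√L))`.
* §3 `forall_interior_chiGood_of_thm1GlobalMinAt` — the FLOOR-FREE form of (R1) part 10's `forall_window_chiGood_of_thm1GlobalMinAt` (p534852): GIVEN
  [Balaban1985Variational] Thm 1 in the tree's global reading `Thm1GlobalMinAt` and the standing thresholds, at EVERY block size and every margin `μ < 1`
  every datum of the `c_L(μ)`-interior, `c_L(μ) := C′⁻¹ = min 1 ((1−μ)L√L/(2B₃))`, is DOUBLY χ-good — the hypothesis `hfloor : 2B₃ ≤ (1−μ)·L√L` of part 10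
  (true at L = 5, FALSE at L = 3 with [7]'s B₃ ≈ 4–4.3) is GONE.  Hence under 19935ᴵ the (R1) edge clause (ii)* has EMPTY domain at every L (not only at
  `L√L ≥ 2B₃/(1−μ)`), and 19935ᴵ(L) follows from the inner stub (i)* + window positivity + Thm 1 for every odd L (`Sketch_ideator2_g13.lean` §8
  `regPrIntL_of_innerChi'`).  Numerically `c₃(μ) = (1−μ)·3√3/(2B₃) ∈ [0.60, 0.65]·(1−μ)` — lane A's kit band constant `c₃ = 1/(g_d√3) ≈ 0.61–0.69`
  (ym3-torus-p2 g14, STATUS 13:45:30Z) is the same number.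

DECISION MATRIX (for OWNER g22; nothing here is filed by this seat):
  19935 AS REGISTERED — L ≥ 7: 3⁗ (no edge); L = 5: {2′, (i)*(5)} + [7] + positivity, (ii)*(5) vacuous by part 10 (floor holds); L = 3: {2′, (i)*(3)} AND the
  genuine edge estimate (ii)*(3) (lane A line (II), located estimate (ii-b) «conditional χ-bad mass», μ = ½).
  19935ᴵ (C8, c := c_L(μ)) — NO block size needs edge mathematics; cost = #3 `HistoryTailL` served at profile `c_L·b₀` (its text already quantifies every
  profile above arbitrary thresholds), one `workitem add` (§1 text), one `route edit --closes-file` (`closesInt`), skeleton re-registration with 4′ ↦ (i)*.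

References: T. Bałaban, CMP 102 (1985) 277–309 [Balaban1985Variational] Thm 1 (8) p.279; CMP 102 (1985) 255–275 [Balaban1985UV3] (41) p.266, (47) p.267;
C. King, CMP 103 (1986) 323–349 [King1986] Prop. 3.8–3.9 pp.664–665.
-/

noncomputable section

namespace Summit.QuantumFields.YangMills.Cruxes.FluctuationComparisonRegPr.Ideate2Gen14

open scoped BigOperators Topology Classical MeasureTheory Matrix
open Filter Set Function MeasureTheory

/-! ## §1 The C8 item text, inline over tree declarations -/

/-- **19935ᴵ — THE PROPOSED ITEM TEXT, INLINE** (quantifier prefix of `FluctuationComparisonRegPrL` verbatim with ONE interior constant `c ∈ (0,1]` per block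
size chosen together with the thresholds; the a.e. clause of `T3RegularMinimiser.BgFluctuationAt` asserted only for steps `K ≥ 1` and only at data in the
`c`-interior `PlaqSmall (θBal(c·b₀) ⌊K/m⌋)` of the window; the two restricted densities are the route's — events `histGood (θBal b₀ p₀)`, nothing re-windowed).
Hypothesis schema, never asserted. [cite: King1986, Prop. 3.8-3.9 pp.664-665] -/
def FluctuationComparisonRegPrIntL : Prop :=
  open Literature.MathematicalPhysics.QuantumFieldTheory.Balaban1983to89 Literature.MathematicalPhysics.QuantumFieldTheory.Balaban1983to89.T3ContinuumYM3Torus Literature.MathematicalPhysics.QuantumFieldTheory.Balaban1983to89.T3UnitScaleTilt Literature.MathematicalPhysics.QuantumFieldTheory.Balaban1983to89.T3TiltDescent Literature.MathematicalPhysics.QuantumFieldTheory.Balaban1983to89.T3PrintedRegularMinimiser in ∀ (L : ℕ), ∃ (c b₁ p₁ : ℝ), 0 < c ∧ c ≤ 1 ∧ ∀ (b₀ p₀ : ℝ), b₁ ≤ b₀ → p₁ ≤ p₀ → 0 < b₀ → 2 < p₀ → ∃ ε₁ : ℝ, 0 < ε₁ ∧ ∀ (ε₀ : ℝ), 0 <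 ε₀ → ε₀ ≤ ε₁ → ∃ m₀ : ℕ, ∀ (m : ℕ), m₀ ≤ m → ∃ γ₁ : ℝ, 0 < γ₁ ∧ ∀ (F : T3Family) (γ : ℝ), F.L = L → 0 < γ → γ ≤ γ₁ → ∃ (r κ : ℕ → ℝ), Summable r ∧ (∀ K, 0 ≤ r K) ∧ ∀ K, 0 < K → ∀ᵐ V ∂fieldMeasure (F.P (K / m)) 0 (Matrix.specialUnitaryGroup (Fin 2) ℂ), PlaqSmall (θBal F.L γ (c * b₀) p₀ (K / m)) V → 0 < heightDensity F γ (Nat.div_le_self K m) (histGood F T3UnitLawDensityEML.ℰp (θBal F.L γ b₀ p₀) K (K / m)) V ∧ 0 < heightDensity F γ ((Nat.div_le_self K m).trans (Nat.le_succ K)) (histGood F T3UnitLawDensityEML.ℰp (θBal F.L γ b₀ p₀) (K + 1) (K / m)) V ∧ |(Real.log (heightDensity F γ ((Nat.div_le_self K m).trans (Nat.le_succ K)) (histGood F T3UnitLawDensityEML.ℰp (θBal F.L γ b₀ p₀) (K + 1) (K / m)) V) + bgRegPr' F γ m ε₀ K V) - (Real.log (heightDensity F γ (Nat.div_le_self K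 m) (histGood F T3UnitLawDensityEML.ℰp (θBal F.L γ b₀ p₀) K (K / m)) V) + bgRegPr F γ m ε₀ K V) - κ K| ≤ r K

open Literature.MathematicalPhysics.QuantumFieldTheory.Balaban1983to89
open Literature.MathematicalPhysics.QuantumFieldTheory.Balaban1983to89.T3ContinuumYM3Torus
open Literature.MathematicalPhysics.QuantumFieldTheory.Balaban1983to89.T3UnitLawDensityEML (ℰp measurableE_ℰp)
open Literature.MathematicalPhysics.QuantumFieldTheory.Balaban1983to89.T3UnitScaleTilt
open Literature.MathematicalPhysics.QuantumFieldTheory.Balaban1983to89.T3TiltDescent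
open Literature.MathematicalPhysics.QuantumFieldTheory.Balaban1983to89.T3RegularMinimiser
open Literature.MathematicalPhysics.QuantumFieldTheory.Balaban1983to89.T3PrintedRegularMinimiser
open Literature.MathematicalPhysics.QuantumFieldTheory.Balaban1983to89.T3PrintedMinimiserExistence
open Literature.MathematicalPhysics.QuantumFieldTheory.Balaban1983to89.T3MinimiserStabilityReduction (θBal_pos)
open Literature.MathematicalPhysics.QuantumFieldTheory.Balaban1983to89.ExpMeanLog (deltaSU deltaSU_pos)
open Literature.MathematicalPhysics.QuantumFieldTheory.Balaban1983to89.Missing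

/-- **19935 ⇒ 19935ᴵ**: the proposed text is FORMALLY WEAKER than the item of record (`c = 1`, drop the step `K = 0`). [cite: King1986, Prop. 3.8-3.9 pp.664-665] -/
theorem regPrIntL_of_regPrL (h : Theses.UnitScaleTilt.FluctuationComparisonRegPrL) : FluctuationComparisonRegPrIntL := by
  intro L
  obtain ⟨b₁, p₁, hB⟩ := h L
  refine ⟨1, b₁, p₁, one_pos, le_rfl, fun b₀ p₀ hb₁ hp₁ hb hp => ?_⟩
  obtain ⟨ε₁, hε₁, hB'⟩ := hB b₀ p₀ hb₁ hp₁ hb hp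
  refine ⟨ε₁, hε₁, fun ε₀ hε hεle => ?_⟩
  obtain ⟨m₀, hm⟩ := hB' ε₀ hε hεle
  refine ⟨m₀, fun m hmle => ?_⟩
  obtain ⟨γ₁, hγ₁, hB''⟩ := hm m hmle
  refine ⟨γ₁, hγ₁, fun F γ hL hγ hle => ?_⟩
  obtain ⟨r, κ, hr, hr0, hae⟩ := hB'' F γ hL hγ hle
  refine ⟨r, κ, hr, hr0, fun K _ => ?_⟩
  filter_upwards [hae K] with V hV hs
  rw [one_mul] at hs
  exact hV hs

/-! ### The nested spelling of `Sketch_ideator2_g13.lean` §1 (re-declared verbatim; that file is not importable) and the `Iff.rfl` -/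

section Nested

variable (F : T3Family) (γ b₀ p₀ : ℝ) (m : ℕ)
  (A₀ A₁ : (K : ℕ) → GaugeField (F.P (K / m)) 0 (Matrix.specialUnitaryGroup (Fin 2) ℂ) → ℝ) (c : ℝ)

/-- `…Ideate2Excision.BgFluctuationIntAt` verbatim. [cite: King1986, Prop. 3.8-3.9 pp.664-665] -/
def BgFluctuationIntAt : Prop :=
  ∃ (r κ : ℕ → ℝ), Summable r ∧ (∀ K, 0 ≤ r K) ∧
    ∀ K, 0 < K → ∀ᵐ V ∂fieldMeasure (F.P (K / m)) 0 (Matrix.specialUnitaryGroup (Fin 2) ℂ),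
      PlaqSmall (θBal F.L γ (c * b₀) p₀ (K / m)) V →
        0 < heightDensity F γ (Nat.div_le_self K m) (histGood F ℰp (θBal F.L γ b₀ p₀) K (K / m)) V ∧
        0 < heightDensity F γ ((Nat.div_le_self K m).trans (Nat.le_succ K)) (histGood F ℰp (θBal F.L γ b₀ p₀) (K + 1) (K / m)) V ∧
        |(Real.log (heightDensity F γ ((Nat.div_le_self K m).trans (Nat.le_succ K))
              (histGood F ℰp (θBal F.L γ b₀ p₀) (K + 1) (K / m)) V) + A₁ K V) -
          (Real.log (heightDensity F γ (Nat.div_le_self K m) (histGood F ℰp (θBal F.L γ b₀ p₀) K (K / m)) V) + A₀ K V) -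
            κ K| ≤ r K

variable (ε₀ : ℝ)

/-- `…Ideate2Excision.FluctuationComparisonRegPrIntAt` verbatim. [cite: Balaban1985UV3, (41) p.266] -/
def FluctuationComparisonRegPrIntAt : Prop :=
  BgFluctuationIntAt F γ b₀ p₀ m (bgRegPr F γ m ε₀) (bgRegPr' F γ m ε₀) c

end Nested

/-- `…Ideate2Excision.FluctuationComparisonRegPrIntL` verbatim (the hypothesis of the kernel-checked `closesInt`). [cite: King1986, Prop. 3.8-3.9 pp.664-665] -/
def FluctuationComparisonRegPrIntLNested : Prop :=
  ∀ (L : ℕ), ∃ (c b₁ p₁ : ℝ), 0 < c ∧ c ≤ 1 ∧ ∀ (b₀ p₀ : ℝ), b₁ ≤ b₀ → p₁ ≤ p₀ → 0 < b₀ → 2 < p₀ →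
    ∃ ε₁ : ℝ, 0 < ε₁ ∧ ∀ (ε₀ : ℝ), 0 < ε₀ → ε₀ ≤ ε₁ → ∃ m₀ : ℕ, ∀ (m : ℕ), m₀ ≤ m →
      ∃ γ₁ : ℝ, 0 < γ₁ ∧ ∀ (F : T3Family) (γ : ℝ), F.L = L → 0 < γ → γ ≤ γ₁ →
        FluctuationComparisonRegPrIntAt F γ b₀ p₀ m c ε₀

/-- The paste-ready inline text IS the glue-checked nested text. [cite: King1986, Prop. 3.8-3.9 pp.664-665] -/
theorem regPrIntL_iff_nested : FluctuationComparisonRegPrIntL ↔ FluctuationComparisonRegPrIntLNested := Iff.rfl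

/-! ## §2 Profile algebra: the C8 interior is (R1)'s shrunken window -/

/-- `θBal` is linear in `b₀` (`p(g) = b₀(1 + log g⁻¹)^{p₀}`). [cite: Balaban1985UV3, (7) p.257] -/
theorem θBal_mul (L : ℕ) (γ c b₀ p₀ : ℝ) (i : ℕ) : θBal L γ (c * b₀) p₀ i = c * θBal L γ b₀ p₀ i := by
  simp only [θBal, B10.pFun]
  ring

/-- The interior radius in the item's spelling with `c = C⁻¹` is the window radius divided by `C`. [cite: Balaban1985UV3, (7) p.257] -/
theorem θBal_inv_mul (L : ℕ) (γ C b₀ p₀ : ℝ) (i : ℕ) : θBal L γ (C⁻¹ * b₀) p₀ i = θBal L γ b₀ p₀ i / C := by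
  rw [θBal_mul, div_eq_inv_mul]

/-! ## §3 Floor-free: the `c_L(μ)`-interior is doubly χ-good at every block size, given [7] Thm 1 -/

variable {F : T3Family} {γ b₀ p₀ ε₀ μ : ℝ}

/-- **THE `c_L(μ)`-INTERIOR IS DOUBLY χ-GOOD AT EVERY BLOCK SIZE** — (R1) part 10's `forall_window_chiGood_of_thm1GlobalMinAt` with the block-size floor
`2B₃ ≤ (1−μ)·L√L` REMOVED and the window replaced by C8's interior `PlaqSmall (θBal(c_L(μ)·b₀) ⌊K/m⌋)`, `c_L(μ) = (max 1 (2B₃/((1−μ)·L√L)))⁻¹`: given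
`Thm1GlobalMinAt L a₀ a₁ B₃`, `m ≥ 2`, the standing thresholds and [Balaban1985Averaging] Prop 2's smallness at every height, every interior datum at every
cut-off `K` is χ-good with margin `μ` for run `K` and for run `K+1` (top height by `chiGood_top`, below it by part 9's
`chiGood_of_plaqSmall_shrunk_of_thm1GlobalMinAt`). [cite: Balaban1985Variational, Thm 1 (8) p.279] -/
theorem forall_interior_chiGood_of_thm1GlobalMinAt (hγ : 0 < γ) (hγ1 : γ ≤ 1) (hb : 0 < b₀) (hp : 0 ≤ p₀) (hμ : μ < 1)
    {a₀ a₁ B₃ : ℝ} (hB₃ : 0 < B₃) (hT : Thm1GlobalMinAt F.L a₀ a₁ B₃) {m : ℕ} (hm : 2 ≤ m) (hhi : ε₀ ≤ a₀)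
    (hthr : ∀ n, θBal F.L γ b₀ p₀ n ≤ a₁ ∧ B₃ * θBal F.L γ b₀ p₀ n ≤ ε₀ ∧ 4 * θBal F.L γ b₀ p₀ n < ε₀)
    (hsm : ∀ n, (143 * ((((3 + 4 : ℕ) : ℝ)) ^ 2 / 4) ^ 2) * (B₃ * θBal F.L γ b₀ p₀ n) ≤ 1 / 3 ∧
      2 * (B₃ * θBal F.L γ b₀ p₀ n) ≤ 2 * deltaSU (Fin 2) / (((3 + 4) * F.L : ℕ) : ℝ) ^ 2) :
    ∀ (K : ℕ) (V : GaugeField (F.P (K / m)) 0 (Matrix.specialUnitaryGroup (Fin 2) ℂ)),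
      PlaqSmall (θBal F.L γ ((max 1 (2 * B₃ / ((1 - μ) * ((F.L : ℝ) * Real.sqrt F.L))))⁻¹ * b₀) p₀ (K / m)) V →
        Theorems.PrintChi.ChiGood F γ b₀ p₀ ε₀ μ (Nat.div_le_self K m) V ∧
          Theorems.PrintChi.ChiGood F γ b₀ p₀ ε₀ μ ((Nat.div_le_self K m).trans (Nat.le_succ K)) V := by
  intro K V hV
  rw [θBal_inv_mul] at hV
  have hL : 1 ≤ F.L := F.hL.2.le
  have hC'1 : (1 : ℝ) ≤ max 1 (2 * B₃ / ((1 - μ) * ((F.L : ℝ) * Real.sqrt F.L))) := le_max_left _ _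
  have hθ : 0 < θBal F.L γ b₀ p₀ (K / m) := θBal_pos hL hγ hγ1 hb p₀ (K / m)
  have hδθ : θBal F.L γ b₀ p₀ (K / m) / max 1 (2 * B₃ / ((1 - μ) * ((F.L : ℝ) * Real.sqrt F.L))) ≤ θBal F.L γ b₀ p₀ (K / m) :=
    div_le_self hθ.le hC'1
  obtain ⟨ha₁, hlo, h4⟩ := hthr (K / m)
  obtain ⟨hs3, hs2⟩ := hsm (K / m)
  have hlt' : K / m < K + 1 := Nat.lt_succ_of_le (Nat.div_le_self K m)
  refine ⟨?_, Theorems.PrintChi.chiGood_of_plaqSmall_shrunk_of_thm1GlobalMinAt hγ hγ1 hb hp hμ hB₃ hT hlt' ha₁ hlo hhi hs3 hs2 hV⟩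
  rcases Nat.eq_zero_or_pos K with hK0 | hKpos
  · subst hK0
    -- top height `0 / m = 0`: the datum radius `θ(0)/C′ ≤ θ(0)` is admissible for `chiGood_top`
    have key : ∀ (n : ℕ) (hn : n ≤ 0) (W : GaugeField (F.P n) 0 (Matrix.specialUnitaryGroup (Fin 2) ℂ)) (δ : ℝ),
        PlaqSmall δ W → δ ≤ θBal F.L γ b₀ p₀ n → 4 * θBal F.L γ b₀ p₀ n < ε₀ → 0 < θBal F.L γ b₀ p₀ n →
          Theorems.PrintChi.ChiGood F γ b₀ p₀ ε₀ μ hn W := by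
      intro n hn W δ hW hδ h4W hθn
      obtain rfl : n = 0 := Nat.le_zero.mp hn
      exact Theorems.PrintChi.chiGood_top hW (by linarith) (by linarith)
    exact key (0 / m) (Nat.div_le_self 0 m) V _ hV hδθ h4 hθ
  · have hlt : K / m < K := by
      have h1 : K / m ≤ K / 2 := Nat.div_le_div_left hm (by norm_num)
      omega
    exact Theorems.PrintChi.chiGood_of_plaqSmall_shrunk_of_thm1GlobalMinAt hγ hγ1 hb hp hμ hB₃ hT hlt ha₁ hlo hhi hs3 hs2 hV

/-- **HENCE THE (R1) EDGE SET MISSES THE INTERIOR AT EVERY BLOCK SIZE**: a window datum that is not doubly χ-good lies in the band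
`{¬ PlaqSmall (θBal(c_L(μ)·b₀) ⌊K/m⌋)}` — the domain of the edge clause (ii)* is disjoint from C8's interior, with no block-size floor.
[cite: Balaban1985Variational, Thm 1 (8) p.279] -/
theorem not_interior_of_not_doubly_chiGood (hγ : 0 < γ) (hγ1 : γ ≤ 1) (hb : 0 < b₀) (hp : 0 ≤ p₀) (hμ : μ < 1)
    {a₀ a₁ B₃ : ℝ} (hB₃ : 0 < B₃) (hT : Thm1GlobalMinAt F.L a₀ a₁ B₃) {m : ℕ} (hm : 2 ≤ m) (hhi : ε₀ ≤ a₀)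
    (hthr : ∀ n, θBal F.L γ b₀ p₀ n ≤ a₁ ∧ B₃ * θBal F.L γ b₀ p₀ n ≤ ε₀ ∧ 4 * θBal F.L γ b₀ p₀ n < ε₀)
    (hsm : ∀ n, (143 * ((((3 + 4 : ℕ) : ℝ)) ^ 2 / 4) ^ 2) * (B₃ * θBal F.L γ b₀ p₀ n) ≤ 1 / 3 ∧
      2 * (B₃ * θBal F.L γ b₀ p₀ n) ≤ 2 * deltaSU (Fin 2) / (((3 + 4) * F.L : ℕ) : ℝ) ^ 2)
    (K : ℕ) (V : GaugeField (F.P (K / m)) 0 (Matrix.specialUnitaryGroup (Fin 2) ℂ))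
    (hV : ¬ (Theorems.PrintChi.ChiGood F γ b₀ p₀ ε₀ μ (Nat.div_le_self K m) V ∧
      Theorems.PrintChi.ChiGood F γ b₀ p₀ ε₀ μ ((Nat.div_le_self K m).trans (Nat.le_succ K)) V)) :
    ¬ PlaqSmall (θBal F.L γ ((max 1 (2 * B₃ / ((1 - μ) * ((F.L : ℝ) * Real.sqrt F.L))))⁻¹ * b₀) p₀ (K / m)) V :=
  fun hs => hV (forall_interior_chiGood_of_thm1GlobalMinAt hγ hγ1 hb hp hμ hB₃ hT hm hhi hthr hsm K V hs)

/-- **THE INTERIOR CONSTANT IS A GENUINE INTERIOR CONSTANT**: `0 < c_L(μ) ≤ 1` (as 19935ᴵ requires). [cite: Balaban1985Variational, Thm 1 (8) p.279] -/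
theorem interiorConst_pos_le_one (B₃ μ x : ℝ) :
    0 < (max 1 (2 * B₃ / ((1 - μ) * x)))⁻¹ ∧ (max 1 (2 * B₃ / ((1 - μ) * x)))⁻¹ ≤ 1 := by
  have h1 : (1 : ℝ) ≤ max 1 (2 * B₃ / ((1 - μ) * x)) := le_max_left _ _
  exact ⟨inv_pos.mpr (lt_of_lt_of_le one_pos h1), inv_le_one_of_one_le₀ h1⟩

end Summit.QuantumFields.YangMills.Cruxes.FluctuationComparisonRegPr.Ideate2Gen14

end
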